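import Summits.AnomalousDissipation.AnomalousDissipation.Theorems.GalerkinInvariantLoud.Negative.Clauses
import Summits.AnomalousDissipation.AnomalousDissipation.Theorems.MomentParityMomentClosure
import Literature.Analysis.FluidPDE.TimeAverageMeasureExistence
import Literature.Analysis.FluidPDE.TimeAverageMeasureBasic
import Mathlib.MeasureTheory.Integral.IntervalIntegral.FundThmCalculus

/-!
# Stub `stub_krylovBogoliubov` of the line `conley-continuation-loud-saddles`
# (crux stmt-AnomalousDissipation-14283, `MomentParity.GalerkinInvariantLoud`):
# Krylov–Bogoliubov + Liouville at level `N` for TESTED Galerkin paths, generalized-limit form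

**Statement.** Let `U : ℝ → H` (`H = L²_σ(T³)`) be norm-continuous on `[0, ∞)`, level-`N` and bounded by
`R` for `t ≥ 0`, and solve the Galerkin equations at `(ν, f)` (`f` smooth) in time-INTEGRATED form against
every level-`N` band test `a`: `(U t, a) − (U s, a) = ∫ₛᵗ ⟨F(U τ), a⟩ dτ` for `0 ≤ s ≤ t`, where
`⟨F(u), w⟩ = Torus.nsGeneratorPairing ν f u w`. Then for every generalized (Banach) limit `Λ` there is a
time-average measure `μ` of `U` (`∫ Ψ dμ = Lim_T T⁻¹∫₀ᵀ Ψ(U t) dt` for bounded continuous `Ψ`), and it is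
all-order polynomially stationary for Galerkin NS at `(ν, f, N)` (`IsInvariant ν f N μ`).

**Proof** (Foias–Manley–Rosa–Temam 2001, Ch. IV §3.1 Prop. 3.1 / Thm. 3.1, in finite dimensions;
Krylov–Bogoliubov 1937).
* §1 EXISTENCE for a trajectory in a compact set `K` (here the level ball
  `{IsLevel N} ∩ {‖u‖ ≤ max R 0}`, `MomentParityMomentClosure.isCompact_levelBall`): the functional
  `Ψ ↦ Λ.longTimeAvg (Ψ ∘ U)` on `C_b(H)` is linear (`Torus.exists_linearMap_longTimeAvg`; measurability from
  `ContinuousOn U (Ici 0)`), positive, normalised (`longTimeAvg_one`) and TIGHT with the single compact `K`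
  (a bounded continuous `g` vanishing on `K` has `g (U t) = 0` for `t > 0`, so `|Λ.longTimeAvg (g ∘ U)| ≤ 0`),
  and `H` is Polish, so `RieszRepresentation.exists_probabilityMeasure_of_isTightFunctional` applies — the
  structure of `exists_timeAverageMeasure_holds` (adapted from
  `Theorems/MarginalStabilityChainChainRealisationStubInvariantMeasure.lean`, which is typed for semiflow
  phases and not imported). The defining identity extends to every continuous `F : H → ℝ` (clamp `F` at a bound
  of `|F|` on `K`, `Torus.IsTimeAverageMeasure.integral_eq_of_eqOn`).
* §2 ROWS along the path (the derivative/FTC chain of the taylor-cone sibling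
  `Theorems/MomentParityGalerkinInvariantLoudStubKrylovBogoliubov.lean` §2, for an abstract tested path instead
  of a concrete Galerkin orbit): the integrand `τ ↦ ⟨F(U τ), a⟩` is continuous on `[0, ∞)`
  (`Torus.continuous_nsGeneratorPairing`), so `d/dt (U t, a) = ⟨F(U t), a⟩` for `t > 0`
  (`intervalIntegral.integral_hasDerivAt_right`); chain rule through polynomials
  (`Literature.NumberTheory.Transcendental.hasFDerivAt_eval`, `nsGeneratorPairing_polyGrad`); FTC-2 on `[0, T]`
  gives `∫₀ᵀ ⟨F(U t), ∇p(U t)⟩ dt = P(coords U T) − P(coords U 0)`, a bounded increment, so the time means of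
  the (continuous, `continuous_nsGeneratorPairing_polyGrad`) row tend to `0` and `Λ.longTimeAvg` of the row
  vanishes (`longTimeAvg_eq_of_tendsto`).
* §3 the stub: existence from §1, invariance of EVERY time-average measure of `U` from §2.

Only `t ≥ 0` matters throughout: `timeMean g T` integrates over `(0, T]`.

References: C. Foias, O. Manley, R. Rosa, R. Temam, *Navier–Stokes Equations and Turbulence* (CUP 2001),
Ch. IV §3.1 Prop. 3.1, Cor. 3.1, Thm. 3.1; N. Krylov, N. Bogoliubov, Ann. of Math. 38 (1937) 65–113;
C. Berg, J. P. R. Christensen, P. Ressel, *Harmonic Analysis on Semigroups* (Springer 1984), Ch. 2 Thm. 2.2.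
-/

set_option linter.dupNamespace false

noncomputable section

namespace Summit.AnomalousDissipation.AnomalousDissipation.Theorems.GalerkinInvariantLoud.KrylovBogoliubovTested

open MeasureTheory Filter Topology Set Metric
open scoped ENNReal
open Literature.Analysis.FunctionSpaces Literature.Analysis.FluidPDE
open Summit.AnomalousDissipation.AnomalousDissipation.Theses.MomentParity
open Summit.AnomalousDissipation.AnomalousDissipation.Theorems.CubicParityLoud.Negative (T3 R3 H3)
open Summit.AnomalousDissipation.AnomalousDissipation.Theorems.QuarticGate.Negative (IsLevel IsBandTest polyGrad)
open Summit.AnomalousDissipation.AnomalousDissipation.Theorems.GalerkinInvariantLoud.Negative (IsInvariant)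
open Summit.AnomalousDissipation.AnomalousDissipation.Theorems.MomentParityMomentClosure
  (isCompact_levelBall continuous_nsGeneratorPairing_polyGrad nsGeneratorPairing_polyGrad continuous_eval_pderiv)

/-! ## §1 Time-average measures of a trajectory in a compact set -/

/-- **Clamping.** A continuous real function agrees on a compact set `K` with a BOUNDED continuous function
(clamp `F` between `∓|B|` for a bound `B` of `‖F‖` on `K`). [folklore] -/
theorem exists_bounded_continuous_eqOn {X : Type*} [TopologicalSpace X] {K : Set X} (hK : IsCompact K)
    {F : X → ℝ} (hF : Continuous F) :
    ∃ (F' : X → ℝ) (C : ℝ), Continuous F' ∧ (∀ x, |F' x| ≤ C) ∧ EqOn F F' K := by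
  obtain ⟨B, hB⟩ := hK.exists_bound_of_continuousOn hF.continuousOn
  refine ⟨fun x => max (-|B|) (min (F x) |B|), |B|, continuous_const.max (hF.min continuous_const),
    fun x => abs_le.2 ⟨le_max_left _ _, max_le ((neg_abs_le B).trans (le_abs_self B)) (min_le_right _ _)⟩,
    fun x hx => ?_⟩
  have h : |F x| ≤ |B| := by
    rw [← Real.norm_eq_abs]
    exact (hB x hx).trans (le_abs_self B)
  obtain ⟨h1, h2⟩ := abs_le.1 h
  show F x = max (-|B|) (min (F x) |B|)
  rw [min_eq_left h2, max_eq_right h1]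

/-- A path `U : ℝ → H` which is norm-continuous on `[0, ∞)` is a.e. strongly measurable on `(0, ∞)`.
[folklore] -/
theorem aestronglyMeasurable_of_continuousOn {U : ℝ → H3} (hU : ContinuousOn U (Ici 0)) :
    AEStronglyMeasurable U (volume.restrict (Ioi 0)) :=
  (hU.mono Ioi_subset_Ici_self).aestronglyMeasurable measurableSet_Ioi

/-- **Time-average measures of a trajectory in a compact set exist** (FMRT 2001, Ch. IV §3.1 Prop. 3.1 in
finite dimensions; Krylov–Bogoliubov 1937). If `U` is norm-continuous on `[0, ∞)` with `U t ∈ K` for `t ≥ 0`,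
`K ⊆ H` compact, then for every generalized limit `Λ` there is a Borel probability measure `μ` on `H` with
`∫ Ψ dμ = Λ(T ↦ T⁻¹∫₀ᵀ Ψ(U t) dt)` for every bounded continuous `Ψ`: the right-hand side is a positive
normalised linear functional on `C_b(H)` (`Torus.exists_linearMap_longTimeAvg`), tight because it vanishes on
functions vanishing on `K`, and `H` is Polish (`RieszRepresentation.exists_probabilityMeasure_of_isTightFunctional`,
Berg–Christensen–Ressel 1984, Ch. 2 Thm. 2.2). Structure of `exists_timeAverageMeasure_holds`. [folklore] -/
theorem exists_isTimeAverageMeasure_of_isCompact {K : Set H3} (hK : IsCompact K) {U : ℝ → H3}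
    (hU : ContinuousOn U (Ici 0)) (hUK : ∀ t, 0 ≤ t → U t ∈ K) (Λ : GeneralizedLimit) :
    ∃ μ : Measure H3, Torus.IsTimeAverageMeasure Λ.longTimeAvg U μ := by
  -- adapted from `MarginalStabilityChain…StubInvariantMeasure.stub_invariantMeasure_aux_exists_timeAverageMeasure`
  classical
  haveI : Fact ((2 : ℝ≥0∞) ≠ ∞) := ⟨ENNReal.ofNat_ne_top⟩
  haveI : SecondCountableTopology
      (Lp (EuclideanSpace ℝ (Fin 3)) 2 (volume : Measure (UnitAddTorus (Fin 3)))) :=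
    inferInstance
  haveI : SecondCountableTopology H3 := TopologicalSpace.Subtype.secondCountableTopology _
  haveI : PolishSpace H3 := inferInstance
  obtain ⟨L, hL⟩ := Torus.exists_linearMap_longTimeAvg Λ (aestronglyMeasurable_of_continuousOn hU)
  have hpos : ∀ g : BoundedContinuousFunction H3 ℝ, (∀ x, 0 ≤ g x) → 0 ≤ L g := by
    intro g hg
    rw [hL]
    exact Λ.longTimeAvg_nonneg (fun t => hg (U t)) (C := ‖g‖) fun t _ => by
      rw [← Real.norm_eq_abs]
      exact g.norm_coe_le_norm (U t)
  have hone : L 1 = 1 := by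
    rw [hL]
    exact Λ.longTimeAvg_one
  have htight : Literature.MeasureTheory.RieszRepresentation.IsTightFunctional L := by
    intro ε hε
    refine ⟨K, hK, fun g hg => ?_⟩
    have h0 : |Λ.longTimeAvg (fun t => g (U t))| ≤ 0 :=
      Λ.abs_longTimeAvg_le fun t ht => by rw [hg _ (hUK t ht.le), abs_zero]
    rw [hL]
    exact h0.trans (by positivity)
  obtain ⟨μ, hμ, hint⟩ :=
    Literature.MeasureTheory.RieszRepresentation.exists_probabilityMeasure_of_isTightFunctional L hpos
      htight hone
  refine ⟨μ, hμ, fun Ψ hΨc hΨb => ?_⟩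
  obtain ⟨C, hC⟩ := hΨb.exists_norm_le
  set g : BoundedContinuousFunction H3 ℝ :=
    BoundedContinuousFunction.ofNormedAddCommGroup Ψ hΨc C fun x => hC _ ⟨x, rfl⟩ with hg
  have h := hint g
  rw [hL] at h
  simpa only [hg, BoundedContinuousFunction.coe_ofNormedAddCommGroup] using h

/-- **The defining identity for every continuous observable** (FMRT 2001, Ch. IV §3.1 Cor. 3.1): if the path
stays in the compact `K` for `t ≥ 0` and `μ` is a time-average measure of it, then every continuous
`F : H → ℝ` is `μ`-integrable with `∫ F dμ = Λ(T ↦ T⁻¹∫₀ᵀ F(U t) dt)` (`F` agrees on `K` with its clamp;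
`Torus.IsTimeAverageMeasure.integral_eq_of_eqOn`). [folklore] -/
theorem integral_eq_longTimeAvg_of_continuous {K : Set H3} (hK : IsCompact K) {U : ℝ → H3}
    (hUK : ∀ t, 0 ≤ t → U t ∈ K) {Λ : GeneralizedLimit} {μ : Measure H3}
    (hμ : Torus.IsTimeAverageMeasure Λ.longTimeAvg U μ) {F : H3 → ℝ} (hF : Continuous F) :
    Integrable F μ ∧ ∫ v, F v ∂μ = Λ.longTimeAvg (fun t => F (U t)) := by
  obtain ⟨F', C, hF'c, hF'b, heq⟩ := exists_bounded_continuous_eqOn hK hF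
  exact hμ.integral_eq_of_eqOn hK.isClosed hUK hF'c hF'b heq

/-! ## §2 Derivatives of the tested pairings along a tested path -/

section Path

variable {ν : ℝ} {f : T3 → R3} {N : ℕ} {U : ℝ → H3} (hU : ContinuousOn U (Ici 0))
  (htest : ∀ a : T3 → R3, IsBandTest N a → ∀ s t : ℝ, 0 ≤ s → s ≤ t →
    Torus.pairing (U t).1 a - Torus.pairing (U s).1 a = ∫ τ in s..t, Torus.nsGeneratorPairing ν f (U τ) a)
include hU htest

/-- **The tested Galerkin equations in differential form**: for a level-`N` band test `b`,
`d/dt (U t, b) = ⟨F(U t), b⟩` at every `t > 0` — the integrand `τ ↦ ⟨F(U τ), b⟩` is continuous on `[0, ∞)`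
(`Torus.continuous_nsGeneratorPairing`), so the time-integrated equation from `s = 0` differentiates
(`intervalIntegral.integral_hasDerivAt_right`). [folklore] -/
theorem hasDerivAt_pairing {b : T3 → R3} (hb : IsBandTest N b) {t : ℝ} (ht : 0 < t) :
    HasDerivAt (fun τ => Torus.pairing (U τ).1 b) (Torus.nsGeneratorPairing ν f (U t) b) t := by
  have hG : ContinuousOn (fun τ => Torus.nsGeneratorPairing ν f (U τ) b) (Ici 0) :=
    (Torus.continuous_nsGeneratorPairing ν f hb.1).comp_continuousOn hU
  have hInt : IntervalIntegrable (fun τ => Torus.nsGeneratorPairing ν f (U τ) b) volume 0 t :=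
    (hG.mono Icc_subset_Ici_self).intervalIntegrable_of_Icc ht.le
  have hmeas : StronglyMeasurableAtFilter (fun τ => Torus.nsGeneratorPairing ν f (U τ) b) (𝓝 t) volume :=
    (hG.mono Ioi_subset_Ici_self).stronglyMeasurableAtFilter isOpen_Ioi t ht
  have hcont : ContinuousAt (fun τ => Torus.nsGeneratorPairing ν f (U τ) b) t :=
    hG.continuousAt (Ici_mem_nhds ht)
  have hder := (intervalIntegral.integral_hasDerivAt_right hInt hmeas hcont).const_add
    (Torus.pairing (U 0).1 b)
  refine hder.congr_of_eventuallyEq ?_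
  filter_upwards [Ioi_mem_nhds ht] with τ hτ
  have h := htest b hb 0 τ le_rfl (le_of_lt hτ)
  linarith

/-- **Chain rule for polynomial observables along the path**: for level-`N` band tests `g` and a polynomial
`P`, `d/dt P((U t, g₁), …, (U t, gₘ)) = ⟨F(U t), ∇p(U t)⟩` at every `t > 0` (`hasFDerivAt_eval`,
`nsGeneratorPairing_polyGrad`). [folklore] -/
theorem hasDerivAt_eval (hf : Integrable f volume) {m : ℕ} {g : Fin m → T3 → R3}
    (hg : ∀ i, IsBandTest N (g i)) (P : MvPolynomial (Fin m) ℝ) {t : ℝ} (ht : 0 < t) :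
    HasDerivAt (fun τ => MvPolynomial.eval (fun j => Torus.pairing (U τ).1 (g j)) P)
      (Torus.nsGeneratorPairing ν f (U t) (polyGrad g P (U t))) t := by
  -- adapted from `GalerkinInvariantLoud.KrylovBogoliubov.hasDerivAt_eval_lift` (taylor-cone sibling)
  have hx : HasDerivAt (fun τ => fun j => Torus.pairing (U τ).1 (g j))
      (fun j => Torus.nsGeneratorPairing ν f (U t) (g j)) t :=
    hasDerivAt_pi.2 fun j => hasDerivAt_pairing hU htest (hg j) ht
  have h := (Literature.NumberTheory.Transcendental.hasFDerivAt_eval P _).comp_hasDerivAt t hx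
  have e : Torus.nsGeneratorPairing ν f (U t) (polyGrad g P (U t)) =
      ∑ i, MvPolynomial.eval (fun j => Torus.pairing (U t).1 (g j)) (MvPolynomial.pderiv i P) *
        Torus.nsGeneratorPairing ν f (U t) (g i) :=
    nsGeneratorPairing_polyGrad ν hf (fun i => (hg i).1) P _
  rw [e]
  refine h.congr_deriv ?_
  simp

/-- **Drift of polynomial observables integrates to a boundary term**: for `T ≥ 0`,
`∫₀ᵀ ⟨F(U t), ∇p(U t)⟩ dt = P(coords U T) − P(coords U 0)` (FTC with right derivatives on `[0, T]`; the
observable is continuous on `[0, T]` along the path and the row is continuous on `H`). [folklore] -/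
theorem integral_nsGeneratorPairing_polyGrad_eq_sub (hf : Integrable f volume) {m : ℕ}
    {g : Fin m → T3 → R3} (hg : ∀ i, IsBandTest N (g i)) (P : MvPolynomial (Fin m) ℝ) {T : ℝ}
    (hT : 0 ≤ T) :
    ∫ t in (0 : ℝ)..T, Torus.nsGeneratorPairing ν f (U t) (polyGrad g P (U t)) =
      MvPolynomial.eval (fun j => Torus.pairing (U T).1 (g j)) P -
        MvPolynomial.eval (fun j => Torus.pairing (U 0).1 (g j)) P := by
  have hgs : ∀ i, Torus.IsSmooth (g i) := fun i => (hg i).1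
  refine intervalIntegral.integral_eq_sub_of_hasDeriv_right_of_le (E := ℝ) hT
    (f := fun τ => MvPolynomial.eval (fun j => Torus.pairing (U τ).1 (g j)) P) ?_ ?_ ?_
  · exact (continuous_eval_pderiv hgs P).comp_continuousOn (hU.mono Icc_subset_Ici_self)
  · intro t ht
    exact (hasDerivAt_eval hU htest hf hg P ht.1).hasDerivWithinAt
  · have hFc : Continuous fun u : H3 => Torus.nsGeneratorPairing ν f u (polyGrad g P u) :=
      continuous_nsGeneratorPairing_polyGrad ν hf hgs P
    exact (hFc.comp_continuousOn (hU.mono Icc_subset_Ici_self)).intervalIntegrable_of_Icc hT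

end Path

/-! ## §3 Vanishing rows and the stub -/

/-- **Bounded increments have vanishing time means**: if `∫₀ᵀ h = Φ T − Φ 0` for `T ≥ 0` with `|Φ| ≤ B` on
`[0, ∞)`, then `|T⁻¹∫₀ᵀ h| ≤ 2B/T → 0`. [folklore] -/
theorem tendsto_timeMean_of_eq_sub {h Φ : ℝ → ℝ} {B : ℝ}
    (hΦ : ∀ T, 0 ≤ T → ∫ t in (0 : ℝ)..T, h t = Φ T - Φ 0) (hB : ∀ t, 0 ≤ t → |Φ t| ≤ B) :
    Tendsto (timeMean h) atTop (𝓝 0) := by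
  have hbound : ∀ T, 0 < T → |timeMean h T| ≤ 2 * B * T⁻¹ := by
    intro T hT
    unfold timeMean
    rw [hΦ T hT.le, abs_mul, abs_inv, abs_of_pos hT, mul_comm]
    refine mul_le_mul_of_nonneg_right ?_ (inv_nonneg.2 hT.le)
    calc |Φ T - Φ 0| ≤ |Φ T| + |Φ 0| := abs_sub _ _
      _ ≤ B + B := add_le_add (hB T hT.le) (hB 0 le_rfl)
      _ = 2 * B := by ring
  have hlim : Tendsto (fun T : ℝ => 2 * B * T⁻¹) atTop (𝓝 0) := by
    simpa using tendsto_inv_atTop_zero.const_mul (2 * B)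
  refine squeeze_zero_norm' ?_ hlim
  filter_upwards [eventually_gt_atTop 0] with T hT
  rw [Real.norm_eq_abs]
  exact hbound T hT

/-- **Liouville at level `N`: every time-average measure of a tested Galerkin path is all-order polynomially
stationary** (FMRT 2001, Ch. IV §3.1 Thm. 3.1 in finite dimensions). For level-`N` band tests `g` and a
polynomial `P` the row `u ↦ ⟨F(u), ∇p(u)⟩` is continuous on `H` (`continuous_nsGeneratorPairing_polyGrad`),
hence `μ`-integrable with `∫ row dμ = Λ.longTimeAvg (row ∘ U)` (the path lives in the compact level ball
`{IsLevel N} ∩ {‖u‖ ≤ max R 0}`, `integral_eq_longTimeAvg_of_continuous`), and the time means of the row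
are `T⁻¹ (P(coords U T) − P(coords U 0)) → 0` (`integral_nsGeneratorPairing_polyGrad_eq_sub`, `P ∘ coords`
bounded on the ball), so the generalized long-time average vanishes (`longTimeAvg_eq_of_tendsto`).
[folklore] -/
theorem isInvariant_of_isTimeAverageMeasure {ν : ℝ} {f : T3 → R3} {N : ℕ} {R : ℝ} {U : ℝ → H3}
    (hfs : Torus.IsSmooth f) (hU : ContinuousOn U (Ici 0)) (hlev : ∀ t, 0 ≤ t → IsLevel N (U t))
    (hbd : ∀ t, 0 ≤ t → ‖U t‖ ≤ R)
    (htest : ∀ a : T3 → R3, IsBandTest N a → ∀ s t : ℝ, 0 ≤ s → s ≤ t →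
      Torus.pairing (U t).1 a - Torus.pairing (U s).1 a =
        ∫ τ in s..t, Torus.nsGeneratorPairing ν f (U τ) a)
    {Λ : GeneralizedLimit} {μ : Measure H3} (hμ : Torus.IsTimeAverageMeasure Λ.longTimeAvg U μ) :
    IsInvariant ν f N μ := by
  intro m g P hg
  have hfi : Integrable f volume := hfs.integrable
  have hgs : ∀ i, Torus.IsSmooth (g i) := fun i => (hg i).1
  -- the compact level ball containing the path for `t ≥ 0`
  have hR : 0 ≤ max R 0 := le_max_right _ _
  set K : Set H3 := {u : H3 | IsLevel N u ∧ ‖u‖ ≤ max R 0} with hK_def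
  have hK : IsCompact K := isCompact_levelBall N hR
  have hUK : ∀ t, 0 ≤ t → U t ∈ K := fun t ht => ⟨hlev t ht, (hbd t ht).trans (le_max_left _ _)⟩
  have hFc : Continuous fun u : H3 => Torus.nsGeneratorPairing ν f u (polyGrad g P u) :=
    continuous_nsGeneratorPairing_polyGrad ν hfi hgs P
  obtain ⟨hint, heq⟩ := integral_eq_longTimeAvg_of_continuous hK hUK hμ hFc
  refine ⟨hint, ?_⟩
  rw [heq]
  -- the time means of the row are `T⁻¹ (P(coords U T) − P(coords U 0)) → 0`
  have hΦc : Continuous fun u : H3 => MvPolynomial.eval (fun j => Torus.pairing u.1 (g j)) P :=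
    continuous_eval_pderiv hgs P
  obtain ⟨B, hB⟩ := hK.exists_bound_of_continuousOn hΦc.continuousOn
  refine Λ.longTimeAvg_eq_of_tendsto (tendsto_timeMean_of_eq_sub
    (Φ := fun t => MvPolynomial.eval (fun j => Torus.pairing (U t).1 (g j)) P) (B := B)
    (fun T hT => integral_nsGeneratorPairing_polyGrad_eq_sub hU htest hfi hg P hT) fun t ht => ?_)
  have h := hB (U t) (hUK t ht)
  rwa [Real.norm_eq_abs] at h

/-- **Stub `stub_krylovBogoliubov` (Galerkin Krylov–Bogoliubov + Liouville for tested paths, generalized-limit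
form).** A path `U : [0, ∞) → H`, norm-continuous, level-`N` and bounded by `R` for `t ≥ 0`, solving the
Galerkin equations at `(ν, f)` in time-integrated form against every level-`N` band test, has — for every
generalized (Banach) limit `Λ` — a time-average measure `μ` (`∫ Ψ dμ = Lim_T T⁻¹∫₀ᵀ Ψ(U t) dt` for bounded
continuous `Ψ`; §1, tightness by the compact level ball `{IsLevel N} ∩ {‖u‖ ≤ max R 0}`), and every such `μ`
is all-order polynomially stationary for Galerkin NS at `(ν, f, N)` (§2–§3). FMRT 2001, Ch. IV §3.1
Prop. 3.1 / Thm. 3.1 in finite dimensions. [folklore] -/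
theorem stub_krylovBogoliubov :
    ∀ (ν : ℝ) (f : T3 → R3) (N : ℕ) (R : ℝ) (U : ℝ → H3),
      Torus.IsSmooth f →
      ContinuousOn U (Ici 0) → (∀ t, 0 ≤ t → IsLevel N (U t)) → (∀ t, 0 ≤ t → ‖U t‖ ≤ R) →
      (∀ a : T3 → R3, IsBandTest N a → ∀ s t : ℝ, 0 ≤ s → s ≤ t →
        Torus.pairing (U t).1 a - Torus.pairing (U s).1 a =
          ∫ τ in s..t, Torus.nsGeneratorPairing ν f (U τ) a) →
      ∀ Λ : GeneralizedLimit, ∃ μ : Measure H3,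
        Torus.IsTimeAverageMeasure Λ.longTimeAvg U μ ∧ IsInvariant ν f N μ := by
  intro ν f N R U hfs hU hlev hbd htest Λ
  have hR : 0 ≤ max R 0 := le_max_right _ _
  have hK : IsCompact {u : H3 | IsLevel N u ∧ ‖u‖ ≤ max R 0} := isCompact_levelBall N hR
  obtain ⟨μ, hμ⟩ := exists_isTimeAverageMeasure_of_isCompact hK hU
    (fun t ht => ⟨hlev t ht, (hbd t ht).trans (le_max_left _ _)⟩) Λ
  exact ⟨μ, hμ, isInvariant_of_isTimeAverageMeasure hfs hU hlev hbd htest hμ⟩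

end Summit.AnomalousDissipation.AnomalousDissipation.Theorems.GalerkinInvariantLoud.KrylovBogoliubovTested

end
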